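import Mathlib
import Summits.Ventures.PercRepro2.Defs
import Summits.Ventures.PercRepro2.Independence
import Summits.Ventures.PercRepro2.Harris
import Summits.Ventures.PercRepro2.Graph
import Summits.Ventures.PercRepro2.Exploration
import Summits.Ventures.PercRepro2.HullDefs

/-!
# Opening one edge: the connection relation of `ω[e ↦ open]` (blind cell PercRepro2, typer-1;
for mine-a g3 MINE-A.md §16 (c) — the pinned-line theorem — lead g11 13:50:52Z)

**`conn_update_true_iff`**: for `e = {u, w}`,
`s ↔ x in ω[e ↦ open]  ⟺  s ↔ x in ω  ∨  (s ↔ u ∧ w ↔ x in ω)  ∨  (s ↔ w ∧ u ↔ x in ω)`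
— the cluster of `s` after opening `e` is its old cluster, merged with the old cluster of the far
end of `e` when `e` touches it.

Consequences for two roots `a₁, a₂` with `a₁ ↮ a₂` AFTER opening `e` (`conn_update_true_cases`):
exactly one of (i) the cluster of `a₁` grows (absorbing vertices joined to neither root before)
and the cluster of `a₂` is unchanged, (ii) the mirror, (iii) nothing changes — stated as:
for every `x`, `x ∈ C(a₂)` is unchanged and `x ∈ C(a₁)` can only switch from "in neither" to "in
`C(a₁)`", OR the mirror. This is the structure behind "opening `e` moves a set of `N`-vertices
to one side" (mine-a).
-/

namespace Summit.Ventures.PercRepro2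

namespace OneEdge

variable {V : Type*} {E : Type*} [DecidableEq E]

variable {ends : E → Sym2 V}

/-- `ω ≤ ω[e ↦ open]`. -/
lemma le_update_true (ω : Config E) (e : E) : ω ≤ Function.update ω e true := by
  intro e'
  by_cases h : e' = e
  · subst h; simp
  · rw [Function.update_of_ne h]

/-- **Opening one edge**: for `e = {u, w}`,
`s ↔ x in ω[e ↦ open] ↔ s ↔ x ∨ (s ↔ u ∧ w ↔ x) ∨ (s ↔ w ∧ u ↔ x)` (all in `ω`). -/
theorem conn_update_true_iff {e : E} {u w : V} (hends : ends e = s(u, w)) (ω : Config E)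
    (s x : V) :
    Conn ends (Function.update ω e true) s x ↔
      Conn ends ω s x ∨ (Conn ends ω s u ∧ Conn ends ω w x) ∨ (Conn ends ω s w ∧ Conn ends ω u x) := by
  constructor
  · intro h
    -- the right-hand side, as a set of `x`, is closed under `ω⁺`-adjacency and contains `s`
    have key : x ∈ {y | Conn ends ω s y ∨ (Conn ends ω s u ∧ Conn ends ω w y) ∨
        (Conn ends ω s w ∧ Conn ends ω u y)} := by
      refine mem_of_conn_of_closed (ends := ends) (ω := Function.update ω e true) ?_
        (Or.inl (conn_refl _ _ _)) h
      intro y hy z hyz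
      obtain ⟨_, e', he', hends'⟩ := openGraph_adj.1 hyz
      by_cases hee : e' = e
      · -- the edge is `e` itself: `{y, z} = {u, w}`
        subst hee
        rw [hends, Sym2.eq_iff] at hends'
        rcases hends' with ⟨rfl, rfl⟩ | ⟨rfl, rfl⟩
        · -- `y = u`, `z = w`
          rcases hy with hy | ⟨hsu, hwy⟩ | ⟨hsw, huy⟩
          · exact Or.inr (Or.inl ⟨hy, conn_refl _ _ _⟩)
          · exact Or.inr (Or.inl ⟨hsu, conn_refl _ _ _⟩)
          · exact Or.inl hsw
        · -- `y = w`, `z = u`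
          rcases hy with hy | ⟨hsu, hwy⟩ | ⟨hsw, huy⟩
          · exact Or.inr (Or.inr ⟨hy, conn_refl _ _ _⟩)
          · exact Or.inl hsu
          · exact Or.inr (Or.inr ⟨hsw, conn_refl _ _ _⟩)
      · -- an `ω`-open edge: every disjunct is transported along it
        rw [Function.update_of_ne hee] at he'
        have hyz' : Conn ends ω y z := conn_of_openAdj ⟨e', he', hends'⟩
        rcases hy with hy | ⟨hsu, hwy⟩ | ⟨hsw, huy⟩
        · exact Or.inl (conn_trans hy hyz')
        · exact Or.inr (Or.inl ⟨hsu, conn_trans hwy hyz'⟩)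
        · exact Or.inr (Or.inr ⟨hsw, conn_trans huy hyz'⟩)
    exact key
  · have huw : Conn ends (Function.update ω e true) u w :=
      conn_of_openAdj ⟨e, by simp, hends⟩
    have hmono : ∀ {a b : V}, Conn ends ω a b → Conn ends (Function.update ω e true) a b :=
      fun h => conn_mono (le_update_true ω e) h
    rintro (h | ⟨hsu, hwx⟩ | ⟨hsw, hux⟩)
    · exact hmono h
    · exact conn_trans (conn_trans (hmono hsu) huw) (hmono hwx)
    · exact conn_trans (conn_trans (hmono hsw) (conn_symm huw)) (hmono hux)

/-- **The two-root case structure**: if `a₁ ↮ a₂` after opening `e = {u, w}`, then EITHER the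
cluster of `a₂` is unchanged and the cluster of `a₁` only gains vertices joined to neither root
before, OR the mirror statement holds. -/
theorem conn_update_true_cases {e : E} {u w : V} (hends : ends e = s(u, w)) (ω : Config E)
    {a₁ a₂ : V} (hQ : ¬ Conn ends (Function.update ω e true) a₁ a₂) :
    ((∀ x, Conn ends (Function.update ω e true) a₂ x ↔ Conn ends ω a₂ x) ∧
      (∀ x, Conn ends ω a₁ x → Conn ends (Function.update ω e true) a₁ x) ∧
      (∀ x, Conn ends (Function.update ω e true) a₁ x → ¬ Conn ends ω a₁ x →
        ¬ Conn ends ω a₂ x)) ∨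
    ((∀ x, Conn ends (Function.update ω e true) a₁ x ↔ Conn ends ω a₁ x) ∧
      (∀ x, Conn ends ω a₂ x → Conn ends (Function.update ω e true) a₂ x) ∧
      (∀ x, Conn ends (Function.update ω e true) a₂ x → ¬ Conn ends ω a₂ x →
        ¬ Conn ends ω a₁ x)) := by
  have hmono : ∀ {a b : V}, Conn ends ω a b → Conn ends (Function.update ω e true) a b :=
    fun h => conn_mono (le_update_true ω e) h
  have hQ₀ : ¬ Conn ends ω a₁ a₂ := fun h => hQ (hmono h)
  -- `e` does not join the two clusters
  have h1 : ¬ (Conn ends ω a₁ u ∧ Conn ends ω w a₂) := fun ⟨h₁, h₂⟩ =>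
    hQ ((conn_update_true_iff hends ω a₁ a₂).2 (Or.inr (Or.inl ⟨h₁, h₂⟩)))
  have h2 : ¬ (Conn ends ω a₁ w ∧ Conn ends ω u a₂) := fun ⟨h₁, h₂⟩ =>
    hQ ((conn_update_true_iff hends ω a₁ a₂).2 (Or.inr (Or.inr ⟨h₁, h₂⟩)))
  by_cases hL : Conn ends ω a₁ u ∨ Conn ends ω a₁ w
  · -- `e` touches `C(a₁)`: `C(a₂)` is unchanged, `C(a₁)` may grow by an `N`-cluster
    left
    have hu₂ : ¬ Conn ends ω a₂ u := by
      intro h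
      rcases hL with hL | hL
      · exact hQ₀ (conn_trans hL (conn_symm h))
      · exact h2 ⟨hL, conn_symm h⟩
    have hw₂ : ¬ Conn ends ω a₂ w := by
      intro h
      rcases hL with hL | hL
      · exact h1 ⟨hL, conn_symm h⟩
      · exact hQ₀ (conn_trans hL (conn_symm h))
    refine ⟨fun x => ?_, fun x h => hmono h, fun x hx hx₀ hx₂ => ?_⟩
    · rw [conn_update_true_iff hends ω a₂ x]
      constructor
      · rintro (h | ⟨h, _⟩ | ⟨h, _⟩)
        · exact h
        · exact absurd h hu₂
        · exact absurd h hw₂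
      · exact Or.inl
    · rw [conn_update_true_iff hends ω a₁ x] at hx
      rcases hx with hx | ⟨_, hwx⟩ | ⟨_, hux⟩
      · exact hx₀ hx
      · exact hw₂ (conn_trans hx₂ (conn_symm hwx))
      · exact hu₂ (conn_trans hx₂ (conn_symm hux))
  · -- `e` does not touch `C(a₁)`: `C(a₁)` is unchanged, `C(a₂)` may grow by an `N`-cluster
    right
    have hu₁ : ¬ Conn ends ω a₁ u := fun h => hL (Or.inl h)
    have hw₁ : ¬ Conn ends ω a₁ w := fun h => hL (Or.inr h)
    refine ⟨fun x => ?_, fun x h => hmono h, fun x hx hx₀ hx₁ => ?_⟩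
    · rw [conn_update_true_iff hends ω a₁ x]
      constructor
      · rintro (h | ⟨h, _⟩ | ⟨h, _⟩)
        · exact h
        · exact absurd h hu₁
        · exact absurd h hw₁
      · exact Or.inl
    · rw [conn_update_true_iff hends ω a₂ x] at hx
      rcases hx with hx | ⟨_, hwx⟩ | ⟨_, hux⟩
      · exact hx₀ hx
      · exact hw₁ (conn_trans hx₁ (conn_symm hwx))
      · exact hu₁ (conn_trans hx₁ (conn_symm hux))

end OneEdge

end Summit.Ventures.PercRepro2
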